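import Summits.ValiantsHypothesis.ValiantsHypothesis.Theorems.DefinabilityGapRefinedPatterns
import Mathlib.Analysis.Complex.ExponentialBounds
import HarnessLib

/-!
# DefinabilityGap — the degree road, clause `b = 1`: `t₀(m) > q(m)` for every `m ≥ 20000`

Route `route-ValiantsHypothesis-DefinabilityGap` (decomp-valiant, lens 5: hardness–randomness / PIT axis), supporting
`KIPlantedHitting` (stmt-ValiantsHypothesis-23547) and the degree profile behind `KIAnnihilatorCHDefinable`
(stmt-ValiantsHypothesis-23444). Source: decomp-valiant lens-5 g16, NOTE-g16 §3.5–3.6 (corollary C2 of Theorem A⁺).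

MAIN THEOREMS.
* `q_cube_mul_coinBound_lt_one` — for `m ≥ 20000` the refined first-moment condition of
  `DefinabilityGapRefinedPatterns.kiPer_hits_of_refined` holds at `t = q(m)`:  `q(m)³ · (1 − c^{2q(m)/m})^m < 1`
  (elementary: `c ≥ e^{−1/(m−2)}`, `q ≤ 2(m²+1)` (Bertrand), `e^{−5} > 1/149`, `1 − x ≤ e^{−x}`, `x³⁰/30! ≤ eˣ`).
* `kiPer_hits_degree_le_q` — hence for `m ≥ 20000` NO nonzero polynomial of total degree `≤ q(m)`, of any size,
  annihilates the generator `G_m`; `q_lt_totalDegree_of_annihilator` — the annihilator ideal of `G_m` has initial degree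
  `> q(m)`; `q_lt_card_support_of_annihilator` — sharper: EVERY monomial of every annihilator involves `> q(m)` distinct
  variables (of the `q(m)³` available).
* `degreeOnlyHitting_one` — the DEGREE-ONLY form of clause `b = 1` of `KIPlantedHitting` is TRUE. Together with
  `DefinabilityGapDegreeRoadCeiling` (`degreeOnlyHitting_zero` TRUE, `not_degreeOnlyHitting_of_two_le`: every `b ≥ 2`
  FALSE) this SETTLES the degree road completely: degree alone certifies `KIPlantedHitting` exactly for `b ≤ 1`, and any
  proof of a clause `b ≥ 2` must use the circuit-SIZE hypothesis.

Honest placement: rung 0 of the Valiant ladder (unconditional facts about one explicit generator); `VP ≠ VNP` is not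
proved and nothing here bears on it directly. 0 sorry.
-/

set_option linter.dupNamespace false

noncomputable section

open MvPolynomial
open Literature.Computability.AlgebraicComplexity Literature.Computability.MetaComplexity
open Summit.ValiantsHypothesis.ValiantsHypothesis.Theorems.DefinabilityGapAffineRung
open Summit.ValiantsHypothesis.ValiantsHypothesis.Theorems.DefinabilityGapAlienExclusion
open Summit.ValiantsHypothesis.ValiantsHypothesis.Theorems.DefinabilityGapRandomPatterns
open Summit.ValiantsHypothesis.ValiantsHypothesis.Theorems.DefinabilityGapBlockStep
open Summit.ValiantsHypothesis.ValiantsHypothesis.Theorems.DefinabilityGapRefinedPatterns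

namespace Summit.ValiantsHypothesis.ValiantsHypothesis.Theorems.DefinabilityGapDegreeRoadOne

variable {m : ℕ}

/-! ## 1. `c ≥ e^{−1/(m−2)}` and the coin bound at `N ≤ 4(m²+1)` -/

/-- `e^{−1/(m−2)} ≤ c = (m−2)/(m−1)` (from `1 + x ≤ eˣ`). [this file] -/
theorem exp_neg_le_cbase (hm : 3 ≤ m) : Real.exp (-(1 / ((m : ℝ) - 2))) ≤ cbase m := by
  have h3 : (3 : ℝ) ≤ m := by exact_mod_cast hm
  have hne2 : (m : ℝ) - 2 ≠ 0 := by linarith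
  have hx : 0 < 1 / ((m : ℝ) - 2) := div_pos one_pos (by linarith)
  have h1 := Real.add_one_le_exp (1 / ((m : ℝ) - 2))
  have hc : (1 / ((m : ℝ) - 2) + 1)⁻¹ = cbase m := by
    rw [div_add_one hne2, inv_div]
    unfold cbase
    congr 1
    ring
  rw [Real.exp_neg, ← hc]
  exact inv_anti₀ (by linarith) h1

/-- `e^{−y/(m−2)} ≤ c^y` for `y ≥ 0`. [this file] -/
theorem exp_neg_le_cbase_rpow (hm : 3 ≤ m) {y : ℝ} (hy : 0 ≤ y) :
    Real.exp (-(y / ((m : ℝ) - 2))) ≤ cbase m ^ y := by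
  have h : -(y / ((m : ℝ) - 2)) = -(1 / ((m : ℝ) - 2)) * y := by ring
  rw [h, Real.exp_mul]
  exact Real.rpow_le_rpow (Real.exp_pos _).le (exp_neg_le_cbase hm) hy

/-- `e^{−5} > 1/149`. [this file] -/
theorem one_div_lt_exp_neg_five : (1 : ℝ) / 149 < Real.exp (-5) := by
  have h5 : Real.exp 5 = Real.exp 1 ^ 5 := by
    rw [← Real.exp_nat_mul]; norm_num
  have hlt : Real.exp 5 < 149 := by
    rw [h5]
    have := Real.exp_one_lt_d9
    have h0 : 0 < Real.exp 1 := Real.exp_pos 1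
    calc Real.exp 1 ^ 5 < (2.7182818286 : ℝ) ^ 5 := by gcongr
      _ < 149 := by norm_num
  rw [Real.exp_neg, div_lt_iff₀ (by norm_num : (0 : ℝ) < 149), inv_mul_eq_div, lt_div_iff₀ (Real.exp_pos 5)]
  linarith

/-- **The coin bound for `N ≤ 4(m²+1)` cells**, `m ≥ 11`: `(1 − c^{N/m})^m ≤ e^{−m/149}`. [this file] -/
theorem coinBound_le_exp (hm : 11 ≤ m) {N : ℕ} (hN : (N : ℝ) ≤ 4 * ((m : ℝ) ^ 2 + 1)) :
    coinBound m N ≤ Real.exp (-((m : ℝ) / 149)) := by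
  have hm3 : 3 ≤ m := by omega
  have h11 : (11 : ℝ) ≤ m := by exact_mod_cast hm
  have hm0 : (0 : ℝ) < m := by linarith
  have hm2 : (0 : ℝ) < (m : ℝ) - 2 := by linarith
  -- the exponent `y = N/m` satisfies `y/(m−2) ≤ 5`
  have hy0 : 0 ≤ (N : ℝ) / m := by positivity
  have hy5 : (N : ℝ) / m / ((m : ℝ) - 2) ≤ 5 := by
    rw [div_div, div_le_iff₀ (mul_pos hm0 hm2)]
    nlinarith
  -- hence `c^y ≥ e^{−5} > 1/149`
  have hcy : (1 : ℝ) / 149 ≤ cbase m ^ ((N : ℝ) / m) := by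
    refine (one_div_lt_exp_neg_five.le.trans ?_).trans (exp_neg_le_cbase_rpow hm3 hy0)
    exact Real.exp_le_exp.2 (by linarith)
  have h0 : 0 ≤ 1 - cbase m ^ ((N : ℝ) / m) :=
    sub_nonneg.2 (Real.rpow_le_one (cbase_nonneg hm3) (cbase_le_one hm3) hy0)
  -- `(1 − c^y)^m ≤ (1 − 1/149)^m ≤ (e^{−1/149})^m = e^{−m/149}`
  have hstep : 1 - cbase m ^ ((N : ℝ) / m) ≤ Real.exp (-(1 / 149)) := by
    have := Real.add_one_le_exp (-(1 / 149 : ℝ))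
    linarith
  unfold coinBound
  calc (1 - cbase m ^ ((N : ℝ) / m)) ^ m ≤ Real.exp (-(1 / 149)) ^ m := pow_le_pow_left₀ h0 hstep m
    _ = Real.exp (-((m : ℝ) / 149)) := by
        rw [← Real.exp_nat_mul]; congr 1; ring

/-! ## 2. The numerics at `t = q(m)`, `m ≥ 20000` -/

/-- `64 m⁶ < e^{m/149}` for `m ≥ 20000` (via `x³⁰/30! ≤ eˣ`). [this file] -/
theorem numeric_lt_exp (hm : 20000 ≤ m) : (64 : ℝ) * (m : ℝ) ^ 6 < Real.exp ((m : ℝ) / 149) := by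
  have hM : (20000 : ℝ) ≤ m := by exact_mod_cast hm
  have hm0 : (0 : ℝ) < m := by linarith
  have hkey : (64 : ℝ) * (149 : ℝ) ^ 30 * (Nat.factorial 30 : ℝ) < (20000 : ℝ) ^ 24 := by
    norm_num [Nat.factorial_succ]
  have h24 : (20000 : ℝ) ^ 24 ≤ (m : ℝ) ^ 24 := pow_le_pow_left₀ (by norm_num) hM 24
  have hexp := Real.pow_div_factorial_le_exp (x := (m : ℝ) / 149) (by positivity) 30
  refine lt_of_lt_of_le ?_ hexp
  rw [div_pow, div_div, lt_div_iff₀ (by positivity)]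
  -- `64 m⁶ (149³⁰ · 30!) < m³⁰`
  have h6 : (0 : ℝ) < (m : ℝ) ^ 6 := by positivity
  calc (64 : ℝ) * (m : ℝ) ^ 6 * ((149 : ℝ) ^ 30 * (Nat.factorial 30 : ℝ))
        = (64 * (149 : ℝ) ^ 30 * (Nat.factorial 30 : ℝ)) * (m : ℝ) ^ 6 := by ring
    _ < (20000 : ℝ) ^ 24 * (m : ℝ) ^ 6 := mul_lt_mul_of_pos_right hkey h6
    _ ≤ (m : ℝ) ^ 24 * (m : ℝ) ^ 6 := mul_le_mul_of_nonneg_right h24 h6.le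
    _ = (m : ℝ) ^ 30 := by ring

/-- **The refined first-moment condition at `t = q(m)`**, `m ≥ 20000`:  `q(m)³ · (1 − c^{2q(m)/m})^m < 1`. [this file] -/
theorem q_cube_mul_coinBound_lt_one (hm : 20000 ≤ m) : (qOf m : ℝ) ^ 3 * coinBound m (2 * qOf m) < 1 := by
  have hM : (20000 : ℝ) ≤ m := by exact_mod_cast hm
  have hq : (qOf m : ℝ) ≤ 2 * ((m : ℝ) * m + 1) := by exact_mod_cast qOf_le m
  have hq0 : (0 : ℝ) ≤ qOf m := Nat.cast_nonneg _
  have hq3 : (qOf m : ℝ) ^ 3 ≤ 64 * (m : ℝ) ^ 6 := by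
    have h4 : (qOf m : ℝ) ≤ 4 * (m : ℝ) ^ 2 := by nlinarith
    calc (qOf m : ℝ) ^ 3 ≤ (4 * (m : ℝ) ^ 2) ^ 3 := pow_le_pow_left₀ hq0 h4 3
      _ = 64 * (m : ℝ) ^ 6 := by ring
  have hN : ((2 * qOf m : ℕ) : ℝ) ≤ 4 * ((m : ℝ) ^ 2 + 1) := by push_cast; nlinarith
  have hCB := coinBound_le_exp (by omega) hN
  have hCB0 : 0 ≤ coinBound m (2 * qOf m) := by
    unfold coinBound
    exact pow_nonneg (sub_nonneg.2 (Real.rpow_le_one (cbase_nonneg (by omega)) (cbase_le_one (by omega))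
      (by positivity))) _
  calc (qOf m : ℝ) ^ 3 * coinBound m (2 * qOf m) ≤ 64 * (m : ℝ) ^ 6 * coinBound m (2 * qOf m) :=
        mul_le_mul_of_nonneg_right hq3 hCB0
    _ ≤ 64 * (m : ℝ) ^ 6 * Real.exp (-((m : ℝ) / 149)) := mul_le_mul_of_nonneg_left hCB (by positivity)
    _ < Real.exp ((m : ℝ) / 149) * Real.exp (-((m : ℝ) / 149)) :=
        mul_lt_mul_of_pos_right (numeric_lt_exp hm) (Real.exp_pos _)
    _ = 1 := by rw [← Real.exp_add, add_neg_cancel, Real.exp_zero]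

/-! ## 3. Clause `b = 1` of the degree road -/

/-- **Degree `≤ q(m)` never annihilates `G_m`** (`m ≥ 20000`): every nonzero `D` with `deg D ≤ q(m)`, of any size,
satisfies `D ∘ G_m ≠ 0`. [this file] -/
theorem kiPer_hits_degree_le_q (hm : 20000 ≤ m) (D : MvPolynomial (Fin 3 → Fin (qOf m)) ℂ) (hD : D ≠ 0)
    (hdeg : D.totalDegree ≤ qOf m) : MvPolynomial.bind₁ (kiPer m) D ≠ 0 :=
  kiPer_hits_of_refined (by omega) (q_cube_mul_coinBound_lt_one hm) D hD hdeg

/-- The annihilator ideal of `G_m` has initial degree `> q(m)` for `m ≥ 20000`. [this file] -/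
theorem q_lt_totalDegree_of_annihilator (hm : 20000 ≤ m) {D : MvPolynomial (Fin 3 → Fin (qOf m)) ℂ} (hD : D ≠ 0)
    (hann : MvPolynomial.bind₁ (kiPer m) D = 0) : qOf m < D.totalDegree := by
  by_contra h
  exact kiPer_hits_degree_le_q hm D hD (not_lt.1 h) hann

/-- **Annihilators have only wide monomials** (`m ≥ 20000`): every monomial of every annihilator of `G_m` involves
more than `q(m)` distinct variables (a first structural constraint on the SIZE road: no nonzero polynomial with a
single "narrow" monomial — e.g. a sparse shift of a wide one — annihilates `G_m`). [this file] -/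
theorem q_lt_card_support_of_annihilator (hm : 20000 ≤ m) {D : MvPolynomial (Fin 3 → Fin (qOf m)) ℂ}
    (hann : MvPolynomial.bind₁ (kiPer m) D = 0) {κ₀ : (Fin 3 → Fin (qOf m)) →₀ ℕ} (hκ₀ : κ₀ ∈ D.support) :
    qOf m < κ₀.support.card := by
  by_contra h
  have hle : κ₀.support.card ≤ qOf m := not_lt.1 h
  have hcount : (qOf m : ℝ) ^ 3 * coinBound m (2 * κ₀.support.card) < 1 :=
    lt_of_le_of_lt (mul_le_mul_of_nonneg_left (coinBound_mono (by omega) (Nat.mul_le_mul_left 2 hle))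
      (by positivity)) (q_cube_mul_coinBound_lt_one hm)
  obtain ⟨π, hπ⟩ := exists_starFree_refined (by omega) κ₀ hcount
  exact kiPer_hits_of_starFree D hκ₀ hπ hann

/-- **The degree-only form of clause `b = 1` of `KIPlantedHitting` is TRUE**: for every `m₀` there is `m ≥ m₀` (indeed
every `m ≥ max m₀ 20000`) such that every nonzero `D` of total degree `≤ q(m)^1` is hit by `G_m` — no size hypothesis.
With `DefinabilityGapDegreeRoadCeiling.degreeOnlyHitting_zero` / `not_degreeOnlyHitting_of_two_le` the degree road is
settled: TRUE for `b ≤ 1`, FALSE for `b ≥ 2`. [this file] -/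
theorem degreeOnlyHitting_one :
    ∀ m₀ : ℕ, ∃ m, m₀ ≤ m ∧ ∀ D : MvPolynomial (Fin 3 → Fin (qOf m)) ℂ, D ≠ 0 →
        D.totalDegree ≤ qOf m ^ 1 → MvPolynomial.bind₁ (kiPer m) D ≠ 0 := by
  intro m₀
  refine ⟨max m₀ 20000, le_max_left _ _, fun D hD hdeg => ?_⟩
  exact kiPer_hits_degree_le_q (le_max_right _ _) D hD (by simpa using hdeg)

end Summit.ValiantsHypothesis.ValiantsHypothesis.Theorems.DefinabilityGapDegreeRoadOne
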